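import Summits.CriticalPhenomena.Ising3D.IsingColumnFaceL11
import Summits.CriticalPhenomena.Ising3D.ExclusionSentencesClassic
import Summits.CriticalPhenomena.Ising3D.ExclusionSentencesKacx
import Summits.CriticalPhenomena.Ising3D.ExclusionSentencesKacPair
import Summits.CriticalPhenomena.Ising3D.ExclusionSentencesCatalan

/-!
# What the certified Λ = 11 column face excludes — the exclusion sentences of Theorem 1 as kernel
theorems (cell `pub-ising3x`, seat recog-1; paper §7)

HONEST FRAMING: lottery ticket; floor = tightest certified 3D Ising CFT bounds; no exact-solution
claim without a proof. Island framing: certified exclusion region at stated derivative order and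
assumptions; not a determination of the 3D Ising critical exponents beyond that.

`IsingColumnFaceL11.lean` proves, MODULO its 42 S3 certificate hypotheses `ColumnCertificatesL11`
(Λ = 11, typed axioms A1–A4), Theorem 1 `isingColumnFace_L11`: every admissible σ–ε datum with
`(Δσ, Δε)` in the window `σcell × [81/64, 8/5]` has `Δε > 2855/2048`. The recognition cell's bridge
lemmas (`ExclusionSentences*.lean`) turn any `IsingEnclosure W R` into printed exclusion sentences.
This file is their instantiation on Theorem 1 — every statement below carries the SAME hypothesis
`(h : ColumnCertificatesL11)` and nothing else, and is either
* PAIR-form (unconditional in shape): the closed segment box `σcell × [81/64, 2855/2048]` is excluded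
  (`colSegment_excluded`), so no admissible datum has `(Δσ, Δε)` equal to a point of it
  (`pair_not_attained_of_mem_colSegment`; e.g. `(157/303, 4/3)`), or
* WINDOW-CONDITIONAL: for admissible data with `(Δσ, Δε) ∈ σcell × [81/64, 8/5]`, `Δε ≠ y` for every
  `y` of the certified segment `[81/64, 2855/2048]` (`eps_ne_of_mem_segment`) — hence for every catalogue value of the frozen list
  FAMILIES-v1 in the certified segment, whatever its family: the simplest rationals `4/3, 9/7, 11/8,
  13/10, 14/11, 15/11`; the Kac-table weights `4/3 = 2h₁,₃(M(5,6))`, `9/7 = 2h₁,₄(M(4,7))`, `21/16`,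
  `65/48`, `27/20` (as members of `kacFamily 24 8` by name); the extended-table weights `4/3` of
  `W₃(4,5)`, `11/8` of `SM(3,7)`, `73/56` of `SM(5,7)`, `46/35` of `ℤ₅` (members of `kacxFamily`);
  the closed forms `2 log 2`, `2 − log 2`, `1 + ζ(3) − G`, `(3/4)√π`, `(7/9)√π` (via the certified
  enclosures of `ExclusionSentencesPiForms/ZetaValues/Catalan.lean`); and, through the scaling
  relations `ν = 1/(3 − Δε)`, `β = Δσ ν`, `γ = (3 − 2Δσ) ν`, the one-sided bands `ν > 2048/3289`,
  `β > 3087/9568`, `γ > 32173/26312` on the window, whence the classic guesses `ν = 3/5, 7/12, 8/13`,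
  `β = 5/16, 3/10, 4/13`, `γ = 6/5, 7/6, 8/7, 11/9` are excluded on the σ-cell (paper §7.4).
Plus the arithmetic facts behind §7.2/§7.3's «none lies in the box»: the named proposals' `Δσ` values
are outside the σ-cell, their `Δε` values above the face, the named pairs outside the window; NO
Virasoro Kac-table value (`p′ ≤ 24`, level `≤ 8`) lies in the σ-cell (`kacExcluded … [] = true`, one
`decide +kernel`), hence no same-model Kac pair lies in the excluded box; the rationals of
denominator `≤ 1000` in the σ-cell are exactly `157/303, 257/496, 371/716, 414/799`.
WHAT THIS ADDS TO THEOREM 1: nothing logically — each sentence is one bridge instantiation (paper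
§7.1) — but it makes the sentences of §7.2–§7.5 kernel theorems BY NAME, conditional on the window and
on `ColumnCertificatesL11` exactly as Theorem 1 is; nothing is recognised, no false-match model is
invoked, and the float literature point `(0.5181489, 1.412625)` stays allowed (`kpsdv_centre_allowed`).
STATUS (lead WORD #24, 2026-08-28): consequences of `isingColumnFace_L11` modulo its 42 S3 hypotheses
(U-1 PASS 42/42; batch-4 reader B = R-639 (a) fallback under ADDENDUM 18); window-conditional readings
exactly as §7 of the paper; certified exclusion region at stated derivative order and assumptions; not
a determination of the 3D Ising critical exponents beyond that; no P(M·) relevance. NOT in scope and not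
stated: anything about the uncut segment `[6/5, 81/64)` (every value sentence below is restricted to the
certified segment `[81/64, 2855/2048]`), any `Δσ`-only exclusion, any reading of the window.
lottery ticket; floor = tightest certified 3D Ising CFT bounds; no exact-solution claim without a proof.
-/

namespace Summit.CriticalPhenomena.Ising3D
namespace ColumnFaceL11
open Set Literature.MathematicalPhysics.QuantumFieldTheory.ConformalBootstrap3D

/-! ### The excluded segment in pair form -/

/-- **The closed segment box is excluded.** Under the 42 certificate hypotheses no admissible σ–ε
datum has `(Δσ, Δε) ∈ σcell × [81/64, 2855/2048]` — the face value itself included (Theorem 1's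
region is the open half-plane `Δε > 2855/2048`). [folklore] -/
theorem colSegment_excluded (h : ColumnCertificatesL11) :
    BoxExcluded (σcell ×ˢ Icc (81 / 64 : ℝ) (2855 / 2048)) := by
  intro D hD hB
  obtain ⟨hσ, hlo, hhi⟩ := hB
  exact absurd (epsDim_gt_face h D hD hσ hlo) (not_lt.mpr hhi)

/-- No admissible datum attains a point of the excluded segment box (pair sentence; no window
hypothesis on the datum). [folklore] -/
theorem pair_not_attained_of_mem_colSegment (h : ColumnCertificatesL11) {v : ℝ × ℝ}
    (hv : v ∈ σcell ×ˢ Icc (81 / 64 : ℝ) (2855 / 2048)) (D : SigmaEpsilonData)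
    (hD : D.SatisfiesBootstrapAxioms) : (D.Δσ, D.Δε) ≠ v :=
  point_not_attained_of_boxExcluded (colSegment_excluded h) hv D hD

/-- Examples: `157/303` is the simplest rational in the σ-cell, and the pairs `(157/303, 4/3)`,
`(157/303, 9/7)`, `(157/303, 11/8)`, `(157/303, 13/10)` are not attained by any admissible datum.
[folklore] -/
theorem simplest_pairs_not_attained (h : ColumnCertificatesL11) (D : SigmaEpsilonData)
    (hD : D.SatisfiesBootstrapAxioms) :
    (D.Δσ, D.Δε) ≠ ((157 : ℝ) / 303, (4 : ℝ) / 3) ∧ (D.Δσ, D.Δε) ≠ ((157 : ℝ) / 303, (9 : ℝ) / 7) ∧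
      (D.Δσ, D.Δε) ≠ ((157 : ℝ) / 303, (11 : ℝ) / 8) ∧
      (D.Δσ, D.Δε) ≠ ((157 : ℝ) / 303, (13 : ℝ) / 10) := by
  refine ⟨?_, ?_, ?_, ?_⟩ <;> refine pair_not_attained_of_mem_colSegment h ?_ D hD <;>
    simp only [σcell, mem_prod, mem_Icc] <;> norm_num

/-- Honesty check: the floating-point island centre `(0.5181489, 1.412625)` of the literature is NOT in
the excluded segment box (it lies above the face; cf. `kpsdv_centre_mem_region`). [folklore] -/
theorem kpsdv_centre_allowed :
    ((0.5181489 : ℝ), (1.412625 : ℝ)) ∉ σcell ×ˢ Icc (81 / 64 : ℝ) (2855 / 2048) := by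
  simp only [σcell, mem_prod, mem_Icc]
  norm_num

/-! ### Window-conditional sentences for `Δε` (paper §7.3) -/

/-- Theorem 1 read as a number: on the window, `2855/2048 < Δε`. [folklore] -/
theorem epsDim_gt_face_of_window (h : ColumnCertificatesL11) (D : SigmaEpsilonData)
    (hD : D.SatisfiesBootstrapAxioms) (hW : (D.Δσ, D.Δε) ∈ σcell ×ˢ Icc (81 / 64 : ℝ) (8 / 5)) :
    (2855 / 2048 : ℝ) < D.Δε := by
  obtain ⟨hσ, hlo, _⟩ := hW
  exact epsDim_gt_face h D hD hσ hlo

/-- **Generic single-value sentence on the certified segment.** For admissible data in the window,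
`Δε ≠ y` for every `y ∈ [81/64, 2855/2048]` — one instantiation of the bridge `eps_ne_of_isingEnclosure`
on Theorem 1. Every catalogue value of the certified segment, of whatever family, is excluded on the
window by this lemma. (Values below `81/64` are deliberately not addressed: the tiling segment
`[6/5, 81/64)` is uncut and lies outside the window.) [folklore] -/
theorem eps_ne_of_mem_segment (h : ColumnCertificatesL11) {y : ℝ}
    (hy : y ∈ Icc (81 / 64 : ℝ) (2855 / 2048)) (D : SigmaEpsilonData)
    (hD : D.SatisfiesBootstrapAxioms) (hW : (D.Δσ, D.Δε) ∈ σcell ×ˢ Icc (81 / 64 : ℝ) (8 / 5)) :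
    D.Δε ≠ y :=
  eps_ne_of_isingEnclosure (isingColumnFace_L11 h) (fun _ hq => ne_of_gt (lt_of_le_of_lt hy.2 hq))
    D hD hW

/-- Rational form of `eps_ne_of_mem_segment` (family `RAT`, and the rational members of every table).
[folklore] -/
theorem eps_ne_rat_of_mem_segment (h : ColumnCertificatesL11) {r : ℚ}
    (hr : 81 / 64 ≤ r ∧ r ≤ 2855 / 2048) (D : SigmaEpsilonData) (hD : D.SatisfiesBootstrapAxioms)
    (hW : (D.Δσ, D.Δε) ∈ σcell ×ˢ Icc (81 / 64 : ℝ) (8 / 5)) : D.Δε ≠ (r : ℝ) := by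
  have h1 : ((81 / 64 : ℚ) : ℝ) ≤ ((r : ℚ) : ℝ) := Rat.cast_le.mpr hr.1
  have h2 : ((r : ℚ) : ℝ) ≤ ((2855 / 2048 : ℚ) : ℝ) := Rat.cast_le.mpr hr.2
  push_cast at h1 h2
  exact eps_ne_of_mem_segment h ⟨h1, h2⟩ D hD hW

/-- The simplest rationals of the certified segment (denominator `≤ 12`): on the window
`Δε ∉ {4/3, 9/7, 11/8, 13/10, 14/11, 15/11}`. [folklore] -/
theorem eps_ne_simplest_rationals (h : ColumnCertificatesL11) (D : SigmaEpsilonData)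
    (hD : D.SatisfiesBootstrapAxioms) (hW : (D.Δσ, D.Δε) ∈ σcell ×ˢ Icc (81 / 64 : ℝ) (8 / 5)) :
    D.Δε ≠ 4 / 3 ∧ D.Δε ≠ 9 / 7 ∧ D.Δε ≠ 11 / 8 ∧ D.Δε ≠ 13 / 10 ∧ D.Δε ≠ 14 / 11 ∧
      D.Δε ≠ 15 / 11 :=
  ⟨eps_ne_of_mem_segment h ⟨by norm_num, by norm_num⟩ D hD hW,
    eps_ne_of_mem_segment h ⟨by norm_num, by norm_num⟩ D hD hW,
    eps_ne_of_mem_segment h ⟨by norm_num, by norm_num⟩ D hD hW,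
    eps_ne_of_mem_segment h ⟨by norm_num, by norm_num⟩ D hD hW,
    eps_ne_of_mem_segment h ⟨by norm_num, by norm_num⟩ D hD hW,
    eps_ne_of_mem_segment h ⟨by norm_num, by norm_num⟩ D hD hW⟩

/-! ### Kac-table and extended-table weights of the segment, by name (families `KAC`, `KACX`) -/

/-- Membership in the `KAC` table from the index ranges (the family's definition, repackaged).
[folklore] -/
theorem kacValue_mem_kacFamily {p p' r s n : ℕ}
    (hk : 2 ≤ p ∧ p < p' ∧ p' ≤ 24 ∧ Nat.Coprime p p' ∧ 1 ≤ r ∧ r < p ∧ 1 ≤ s ∧ s < p' ∧ n ≤ 8) :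
    kacValue p p' r s n ∈ kacFamily 24 8 :=
  ⟨p, p', r, s, n, hk.1, hk.2.1, hk.2.2.1, hk.2.2.2.1, hk.2.2.2.2.1, hk.2.2.2.2.2.1, hk.2.2.2.2.2.2.1,
    hk.2.2.2.2.2.2.2.1, hk.2.2.2.2.2.2.2.2, rfl⟩

/-- The five Kac-table examples of §7.3 are members of `kacFamily 24 8` with the printed labels:
`2h₁,₃(M(5,6))`, `2h₁,₄(M(4,7))`, `2h₁,₂(M(7,8)) + 1`, `2h₂,₄(M(8,9))`, `2h₁,₂(M(9,10)) + 1`.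
[folklore] -/
theorem kac_examples_mem :
    kacValue 5 6 1 3 0 ∈ kacFamily 24 8 ∧ kacValue 4 7 1 4 0 ∈ kacFamily 24 8 ∧
      kacValue 7 8 1 2 1 ∈ kacFamily 24 8 ∧ kacValue 8 9 2 4 0 ∈ kacFamily 24 8 ∧
      kacValue 9 10 1 2 1 ∈ kacFamily 24 8 :=
  ⟨kacValue_mem_kacFamily (by decide), kacValue_mem_kacFamily (by decide),
    kacValue_mem_kacFamily (by decide), kacValue_mem_kacFamily (by decide),
    kacValue_mem_kacFamily (by decide)⟩

/-- Their values: `4/3, 9/7, 21/16, 65/48, 27/20` — all in the certified segment. [folklore] -/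
theorem kac_examples_values :
    kacValue 5 6 1 3 0 = 4 / 3 ∧ kacValue 4 7 1 4 0 = 9 / 7 ∧ kacValue 7 8 1 2 1 = 21 / 16 ∧
      kacValue 8 9 2 4 0 = 65 / 48 ∧ kacValue 9 10 1 2 1 = 27 / 20 := by
  norm_num [kacValue, kacNum]

/-- **KAC examples on the window:** `Δε` is none of `2h₁,₃(M(5,6)) = 4/3`, `2h₁,₄(M(4,7)) = 9/7`,
`2h₁,₂(M(7,8)) + 1 = 21/16`, `2h₂,₄(M(8,9)) = 65/48`, `2h₁,₂(M(9,10)) + 1 = 27/20`. [folklore] -/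
theorem eps_ne_kac_examples (h : ColumnCertificatesL11) (D : SigmaEpsilonData)
    (hD : D.SatisfiesBootstrapAxioms) (hW : (D.Δσ, D.Δε) ∈ σcell ×ˢ Icc (81 / 64 : ℝ) (8 / 5)) :
    D.Δε ≠ (kacValue 5 6 1 3 0 : ℚ) ∧ D.Δε ≠ (kacValue 4 7 1 4 0 : ℚ) ∧
      D.Δε ≠ (kacValue 7 8 1 2 1 : ℚ) ∧ D.Δε ≠ (kacValue 8 9 2 4 0 : ℚ) ∧
      D.Δε ≠ (kacValue 9 10 1 2 1 : ℚ) := by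
  obtain ⟨e1, e2, e3, e4, e5⟩ := kac_examples_values
  refine ⟨?_, ?_, ?_, ?_, ?_⟩ <;> refine eps_ne_rat_of_mem_segment h ?_ D hD hW
  · rw [e1]; norm_num
  · rw [e2]; norm_num
  · rw [e3]; norm_num
  · rw [e4]; norm_num
  · rw [e5]; norm_num

/-- The four extended-table examples of §7.3 are members of `kacxFamily` with the printed labels:
`2h_{1,1;1,3}(W₃(4,5))`, `2h₁,₆(SM(3,7))`, `2h₁,₄(SM(5,7))`, `2h_{l=1,m=−7}(ℤ₅)`. [folklore] -/
theorem kacx_examples_mem :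
    2 * w3Weight 4 5 1 1 1 3 ∈ kacxFamily ∧ 2 * n1Weight 3 7 1 6 ∈ kacxFamily ∧
      2 * n1Weight 5 7 1 4 ∈ kacxFamily ∧ 2 * zkWeight 5 1 (-7) ∈ kacxFamily := by
  refine ⟨?_, ?_, ?_, ?_⟩
  · refine Or.inl (Or.inl (Or.inr ?_))
    exact ⟨4, 5, 1, 1, 1, 3, by decide, by decide, by decide, by decide, by decide, by decide,
      by decide, by decide, by decide, by decide, by norm_num [w3Weight, w3Num], Or.inr rfl⟩
  · refine Or.inl (Or.inl (Or.inl ?_))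
    exact ⟨3, 7, 1, 6, by decide, by decide, by decide, by decide, by decide, by decide, by decide,
      by decide, by norm_num [n1Weight, n1Num, kacNum], Or.inr rfl⟩
  · refine Or.inl (Or.inl (Or.inl ?_))
    exact ⟨5, 7, 1, 4, by decide, by decide, by decide, by decide, by decide, by decide, by decide,
      by decide, by norm_num [n1Weight, n1Num, kacNum], Or.inr rfl⟩
  · refine Or.inr ?_
    exact ⟨5, 1, -7, by decide, by decide, by decide, by decide, by decide, by decide,
      by norm_num [zkWeight, zkNum], Or.inr rfl⟩

/-- Their values: `4/3, 11/8, 73/56, 46/35` — all in the certified segment. [folklore] -/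
theorem kacx_examples_values :
    2 * w3Weight 4 5 1 1 1 3 = 4 / 3 ∧ 2 * n1Weight 3 7 1 6 = 11 / 8 ∧
      2 * n1Weight 5 7 1 4 = 73 / 56 ∧ 2 * zkWeight 5 1 (-7) = 46 / 35 := by
  norm_num [w3Weight, w3Num, n1Weight, n1Num, kacNum, zkWeight, zkNum]

/-- **KACX examples on the window:** `Δε` is none of `2h_{1,1;1,3}(W₃(4,5)) = 4/3`,
`2h₁,₆(SM(3,7)) = 11/8`, `2h₁,₄(SM(5,7)) = 73/56`, `2h_{1,−7}(ℤ₅) = 46/35`. [folklore] -/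
theorem eps_ne_kacx_examples (h : ColumnCertificatesL11) (D : SigmaEpsilonData)
    (hD : D.SatisfiesBootstrapAxioms) (hW : (D.Δσ, D.Δε) ∈ σcell ×ˢ Icc (81 / 64 : ℝ) (8 / 5)) :
    D.Δε ≠ ((2 * w3Weight 4 5 1 1 1 3 : ℚ) : ℝ) ∧ D.Δε ≠ ((2 * n1Weight 3 7 1 6 : ℚ) : ℝ) ∧
      D.Δε ≠ ((2 * n1Weight 5 7 1 4 : ℚ) : ℝ) ∧ D.Δε ≠ ((2 * zkWeight 5 1 (-7) : ℚ) : ℝ) := by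
  obtain ⟨e1, e2, e3, e4⟩ := kacx_examples_values
  refine ⟨?_, ?_, ?_, ?_⟩ <;> refine eps_ne_rat_of_mem_segment h ?_ D hD hW
  · rw [e1]; norm_num
  · rw [e2]; norm_num
  · rw [e3]; norm_num
  · rw [e4]; norm_num

/-! ### Closed forms in classical constants (families `LIN`, `TRG`): the §7.3 examples -/

/-- On the window `Δε ≠ 2 log 2` (= 1.38629…; `LIN`, height 2). [folklore] -/
theorem eps_ne_two_mul_log_two (h : ColumnCertificatesL11) (D : SigmaEpsilonData)
    (hD : D.SatisfiesBootstrapAxioms) (hW : (D.Δσ, D.Δε) ∈ σcell ×ˢ Icc (81 / 64 : ℝ) (8 / 5)) :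
    D.Δε ≠ 2 * Real.log 2 := by
  have h1 := log2_mem_log2I.1
  have h2 := log2_mem_log2I.2
  simp only [log2I] at h1 h2
  push_cast at h1 h2
  exact eps_ne_of_mem_segment h ⟨by linarith, by linarith⟩ D hD hW

/-- On the window `Δε ≠ 2 − log 2` (= 1.30685…; `LIN`, height 2). [folklore] -/
theorem eps_ne_two_sub_log_two (h : ColumnCertificatesL11) (D : SigmaEpsilonData)
    (hD : D.SatisfiesBootstrapAxioms) (hW : (D.Δσ, D.Δε) ∈ σcell ×ˢ Icc (81 / 64 : ℝ) (8 / 5)) :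
    D.Δε ≠ 2 - Real.log 2 := by
  have h1 := log2_mem_log2I.1
  have h2 := log2_mem_log2I.2
  simp only [log2I] at h1 h2
  push_cast at h1 h2
  exact eps_ne_of_mem_segment h ⟨by linarith, by linarith⟩ D hD hW

/-- On the window `Δε ≠ 1 + ζ(3) − G` (= 1.28609…; `LIN`, height 1; `zeta3`, `catalan` are the
tree's certified constants, `zeta3 = ζ(3)` by `zeta3_eq_riemannZeta`). [folklore] -/
theorem eps_ne_one_add_zeta3_sub_catalan (h : ColumnCertificatesL11) (D : SigmaEpsilonData)
    (hD : D.SatisfiesBootstrapAxioms) (hW : (D.Δσ, D.Δε) ∈ σcell ×ˢ Icc (81 / 64 : ℝ) (8 / 5)) :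
    D.Δε ≠ 1 + zeta3 - catalan := by
  have hz1 := zeta3_mem_zeta3I.1
  have hz2 := zeta3_mem_zeta3I.2
  have hg1 := catalan_mem_catalanI.1
  have hg2 := catalan_mem_catalanI.2
  simp only [zeta3I] at hz1 hz2
  simp only [catalanI] at hg1 hg2
  push_cast at hz1 hz2 hg1 hg2
  exact eps_ne_of_mem_segment h ⟨by linarith, by linarith⟩ D hD hW

/-- On the window `Δε ≠ (3/4)√π` (= 1.32934…; `TRG`) and `Δε ≠ (7/9)√π` (= 1.37857…). [folklore] -/
theorem eps_ne_sqrt_pi_examples (h : ColumnCertificatesL11) (D : SigmaEpsilonData)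
    (hD : D.SatisfiesBootstrapAxioms) (hW : (D.Δσ, D.Δε) ∈ σcell ×ˢ Icc (81 / 64 : ℝ) (8 / 5)) :
    D.Δε ≠ 3 / 4 * Real.sqrt Real.pi ∧ D.Δε ≠ 7 / 9 * Real.sqrt Real.pi := by
  have hs1 := sqrtPi_mem_sqrtPiI.1
  have hs2 := sqrtPi_mem_sqrtPiI.2
  simp only [sqrtPiI] at hs1 hs2
  push_cast at hs1 hs2
  exact ⟨eps_ne_of_mem_segment h ⟨by linarith, by linarith⟩ D hD hW,
    eps_ne_of_mem_segment h ⟨by linarith, by linarith⟩ D hD hW⟩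

/-! ### The classic exponent guesses through the scaling relations (paper §7.4, family `CLASSIC`) -/

/-- **`ν` band.** On the window `ν = 1/(3 − Δε) > 2048/3289` (= 0.62268…). [folklore] -/
theorem nu_gt_face (h : ColumnCertificatesL11) (D : SigmaEpsilonData)
    (hD : D.SatisfiesBootstrapAxioms) (hW : (D.Δσ, D.Δε) ∈ σcell ×ˢ Icc (81 / 64 : ℝ) (8 / 5)) :
    (2048 / 3289 : ℝ) < 1 / (3 - D.Δε) := by
  obtain ⟨hσ, hlo, hhi⟩ := hW
  have hε := epsDim_gt_face h D hD hσ hlo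
  have h3 : 0 < 3 - D.Δε := by linarith
  rw [lt_div_iff₀ h3]
  linarith

/-- **`β` band.** On the window `β = Δσ/(3 − Δε) > 3087/9568` (= 0.32263…; worst case `Δσ = σ_lo`).
[folklore] -/
theorem beta_gt_face (h : ColumnCertificatesL11) (D : SigmaEpsilonData)
    (hD : D.SatisfiesBootstrapAxioms) (hW : (D.Δσ, D.Δε) ∈ σcell ×ˢ Icc (81 / 64 : ℝ) (8 / 5)) :
    (3087 / 9568 : ℝ) < betaOf D.Δσ D.Δε := by
  obtain ⟨hσ, hlo, hhi⟩ := hW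
  have hε := epsDim_gt_face h D hD hσ hlo
  have hσ' : (33957 / 65536 : ℝ) ≤ D.Δσ ∧ D.Δσ ≤ 16979 / 32768 := by
    simpa only [σcell, mem_Icc] using hσ
  have h3 : 0 < 3 - D.Δε := by linarith
  rw [betaOf, lt_div_iff₀ h3]
  linarith [hσ'.1]

/-- **`γ` band.** On the window `γ = (3 − 2Δσ)/(3 − Δε) > 32173/26312` (= 1.22275…; worst case
`Δσ = σ_hi`). [folklore] -/
theorem gamma_gt_face (h : ColumnCertificatesL11) (D : SigmaEpsilonData)
    (hD : D.SatisfiesBootstrapAxioms) (hW : (D.Δσ, D.Δε) ∈ σcell ×ˢ Icc (81 / 64 : ℝ) (8 / 5)) :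
    (32173 / 26312 : ℝ) < gammaOf D.Δσ D.Δε := by
  obtain ⟨hσ, hlo, hhi⟩ := hW
  have hε := epsDim_gt_face h D hD hσ hlo
  have hσ' : (33957 / 65536 : ℝ) ≤ D.Δσ ∧ D.Δσ ≤ 16979 / 32768 := by
    simpa only [σcell, mem_Icc] using hσ
  have h3 : 0 < 3 - D.Δε := by linarith
  rw [gammaOf, lt_div_iff₀ h3]
  linarith [hσ'.2]

/-- **The classic guesses, excluded on the σ-cell** (window-conditional, Λ = 11 / S3):
`ν ∉ {3/5, 7/12, 8/13}`, `β ∉ {5/16, 3/10, 4/13}` (Essam–Fisher `5/16`), `γ ∉ {6/5, 7/6, 8/7, 11/9}`.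
(`γ = 5/4`, `ν = 5/8, 2/3` correspond to `Δε` above the face and are NOT touched.) [folklore] -/
theorem classic_guesses_excluded (h : ColumnCertificatesL11) (D : SigmaEpsilonData)
    (hD : D.SatisfiesBootstrapAxioms) (hW : (D.Δσ, D.Δε) ∈ σcell ×ˢ Icc (81 / 64 : ℝ) (8 / 5)) :
    (1 / (3 - D.Δε) ≠ 3 / 5 ∧ 1 / (3 - D.Δε) ≠ 7 / 12 ∧ 1 / (3 - D.Δε) ≠ 8 / 13) ∧
      (betaOf D.Δσ D.Δε ≠ 5 / 16 ∧ betaOf D.Δσ D.Δε ≠ 3 / 10 ∧ betaOf D.Δσ D.Δε ≠ 4 / 13) ∧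
      (gammaOf D.Δσ D.Δε ≠ 6 / 5 ∧ gammaOf D.Δσ D.Δε ≠ 7 / 6 ∧ gammaOf D.Δσ D.Δε ≠ 8 / 7 ∧
        gammaOf D.Δσ D.Δε ≠ 11 / 9) := by
  have hn := nu_gt_face h D hD hW
  have hb := beta_gt_face h D hD hW
  have hg := gamma_gt_face h D hD hW
  refine ⟨⟨?_, ?_, ?_⟩, ⟨?_, ?_, ?_⟩, ⟨?_, ?_, ?_, ?_⟩⟩ <;> exact ne_of_gt (by linarith)

/-- Why `γ = 5/4` is untouched: on the σ-cell it corresponds to `Δε = 3 − (4/5)(3 − 2Δσ) > 2855/2048`,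
i.e. to a point above the face; likewise `ν = 5/8, 2/3` mean `Δε = 7/5, 3/2 > 2855/2048`. [folklore] -/
theorem classic_untouched_above_face :
    (∀ x ∈ σcell, (2855 / 2048 : ℝ) < 3 - 4 / 5 * (3 - 2 * x)) ∧
      (2855 / 2048 : ℝ) < 3 - 1 / (5 / 8) ∧ (2855 / 2048 : ℝ) < 3 - 1 / (2 / 3) := by
  refine ⟨fun x hx => ?_, by norm_num, by norm_num⟩
  have hx' : (33957 / 65536 : ℝ) ≤ x ∧ x ≤ 16979 / 32768 := by simpa only [σcell, mem_Icc] using hx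
  linarith [hx'.1]

/-! ### «None lies in the box» (paper §7.2, §7.3): the arithmetic of the σ-cell against the catalogue -/

/-- The named proposals' `Δσ` values (`namedSigma`: Zhang–Kaupužs `9/16`, series-era `1/2`,
Fisher–Burford `19/36`, Thompson `15/31`, Ghosh `899/1728`, Mojumder `3/5`) all lie OUTSIDE the
σ-cell — Theorem 1 says nothing about them. [folklore] -/
theorem namedSigma_not_mem_σcell : ∀ v ∈ namedSigma, ((v : ℚ) : ℝ) ∉ σcell := by
  intro v hv
  simp only [namedSigma, List.mem_cons, List.not_mem_nil, or_false] at hv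
  rcases hv with rfl | rfl | rfl | rfl | rfl | rfl <;> simp only [σcell, mem_Icc] <;> norm_num

/-- The named proposals' `Δε` values (`namedEps`: `3/2, 7/5, 13/9`) all lie ABOVE the face: none is in
the certified segment. [folklore] -/
theorem namedEps_above_face : ∀ v ∈ namedEps, (2855 / 2048 : ℚ) < v := by
  intro v hv
  simp only [namedEps, List.mem_cons, List.not_mem_nil, or_false] at hv
  rcases hv with rfl | rfl | rfl <;> norm_num

/-- The named pairs (`namedPairs`, NAMEDJ + late supplements) all lie OUTSIDE the window
`σcell × [81/64, 8/5]` (their `Δσ` is not in the cell). [folklore] -/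
theorem namedPairs_not_mem_window :
    ∀ v ∈ namedPairs, (((v.1 : ℚ) : ℝ), ((v.2 : ℚ) : ℝ)) ∉ σcell ×ˢ Icc (81 / 64 : ℝ) (8 / 5) := by
  intro v hv
  simp only [namedPairs, List.mem_cons, List.not_mem_nil, or_false] at hv
  rcases hv with rfl | rfl | rfl | rfl | rfl <;> simp only [σcell, mem_prod, mem_Icc] <;> norm_num

/-- **No Virasoro Kac-table value in the σ-cell** (`p′ ≤ 24`, level `≤ 8`; 69 545 values): the kernel
runs the cell's `KAC` checker with the EMPTY exception list. [folklore] -/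
theorem kacExcluded_σcell : kacExcluded 24 8 (33957 / 65536) (16979 / 32768) [] = true := by
  decide +kernel

/-- Hence no member of `kacFamily 24 8` lies in the σ-cell (§7.3: «no Kac … value»). [folklore] -/
theorem kac_not_mem_σcell (v : ℚ) (hv : v ∈ kacFamily 24 8) : (v : ℝ) ∉ σcell := by
  intro hmem
  have h' : ((33957 / 65536 : ℚ) : ℝ) ≤ (v : ℝ) ∧ (v : ℝ) ≤ ((16979 / 32768 : ℚ) : ℝ) := by
    simp only [σcell, mem_Icc] at hmem
    push_cast
    exact hmem
  have := kacExcluded_sound kacExcluded_σcell hv (by exact_mod_cast h'.1) (by exact_mod_cast h'.2)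
  simp at this

/-- Hence **no same-model Kac pair lies in the excluded box** (§7.2: family `KACJ` has no member with
`Δσ` in the σ-cell at all, so Theorem 1 refutes none and none was expected). [folklore] -/
theorem kacPair_not_mem_colSegment (v : ℚ × ℚ) (hv : v ∈ kacPairFamily 24 8) :
    (((v.1 : ℚ) : ℝ), ((v.2 : ℚ) : ℝ)) ∉ σcell ×ˢ Icc (81 / 64 : ℝ) (2855 / 2048) :=
  fun hmem => kac_not_mem_σcell v.1 (fst_mem_kacFamily_of_mem_kacPairFamily hv) hmem.1

/-- The rationals of denominator `≤ 1000` in the σ-cell are among `157/303, 257/496, 371/716, 414/799`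
(the cell's `RAT` checker, one `decide +kernel`). [folklore] -/
theorem ratExcluded_σcell :
    ratExcluded 1000 (33957 / 65536) (16979 / 32768) [157 / 303, 257 / 496, 371 / 716, 414 / 799] =
      true := by
  decide +kernel

/-- … and each of the four does lie in the σ-cell, so the list is exact (§7.3: «4 rationals with
denominator ≤ 1000»). [folklore] -/
theorem σcell_rationals_mem :
    ((157 / 303 : ℚ) : ℝ) ∈ σcell ∧ ((257 / 496 : ℚ) : ℝ) ∈ σcell ∧ ((371 / 716 : ℚ) : ℝ) ∈ σcell ∧
      ((414 / 799 : ℚ) : ℝ) ∈ σcell := by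
  simp only [σcell, mem_Icc]
  norm_num

/-- Real-number form: a rational of denominator `≤ 1000` in the σ-cell is one of the four. [folklore] -/
theorem rat_mem_σcell_iff_listed (r : ℚ) (hden : r.den ≤ 1000) (hr : (r : ℝ) ∈ σcell) :
    r ∈ ([157 / 303, 257 / 496, 371 / 716, 414 / 799] : List ℚ) := by
  have h' : ((33957 / 65536 : ℚ) : ℝ) ≤ (r : ℝ) ∧ (r : ℝ) ≤ ((16979 / 32768 : ℚ) : ℝ) := by
    simp only [σcell, mem_Icc] at hr
    push_cast
    exact hr
  exact ratExcluded_sound ratExcluded_σcell hden (by exact_mod_cast h'.1) (by exact_mod_cast h'.2)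

end ColumnFaceL11
end Summit.CriticalPhenomena.Ising3D
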